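import Summits.Ventures.FusionMHD.Bench.SolovevPCFNstxMercierEdgeData2
import Summits.Ventures.FusionMHD.Bench.SolovevPCFIterMercierEdgeAverages
import HarnessLib

/-!
# F1 / MERCIER (GGJ form) at the plasma EDGE of the NSTX-like PCF Solov'ev equilibrium — the flux functions and surface
# averages of the edge surface as reals, and the two g-UNIFORM bounds on the g-dependent averages
(venture LADDER-GRIDFUSION, rung F1.MERCIER-profile; cell `gridfusion`, seat `gridfusion-sos-6` (g2), 2026-08-27; generator
`pub/gridfusion/cert/sos-6/dm/emit_mercier_ggj.py`. Consumed by `Bench/SolovevPCFNstxMercierEdgeGGJ.lean`, whose §0 states the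
criterion (Jardin 2010 (8.134), Glasser–Greene–Johnson form), the pinned reading and the three columns.)

Content: `V″/V′ = −K₂/(4αρK₁)`, `Φ″/(gV′) = −3K₃/(8παρK₁)`, `⟨1/R²⟩, ⟨R²⟩, ⟨1/|∇Ψ|²⟩, ⟨1/(R²|∇Ψ|²)⟩, ⟨R²/|∇Ψ|²⟩` as quotients of
the kernel-enclosed integrals `K₁…K₈` (Data1/Data2, `K₄ = edgeI`); the g-dependent `⟨1/B²⟩(g) = KY(g)/K₁` and
`g²⟨1/(B²|∇Ψ|²)⟩(g) = KX(g)/K₁` as honest integrals over `[0,1]` in the de-singularised variable; PROVED: `P_σ > 0`, `U_σ > 0`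
on `[0,1]`, continuity, and the uniform bounds `0 ≤ KY(g) ≤ K₅/g²`, `0 ≤ KX(g) ≤ K₈/(4αρ²)` (Mathlib `integral_mono_on`).
HONEST FRAMING: exact definitions and inequalities about explicit one-dimensional integrals of the MODEL (ideal-MHD analytic
Solov'ev equilibrium [cite: PatakiCerfonFreidberg2013, §6.1]); the identification with the flux-surface functionals of
[cite: Jardin2010, §5.3 eq. (5.29)–(5.31)] is the elementary reduction recorded in `…MercierEdgeData1` §0. No stability word.
-/

noncomputable section

open Real MeasureTheory Set intervalIntegral
open Literature.Analysis.ValidatedNumerics Literature.Analysis.ValidatedNumerics.PolyMP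
open Literature.Analysis.ValidatedNumerics.ExpPoly (Poly)

namespace Summit.Ventures.FusionMHD.Bench.SolovevPCFNstx.MercierEdge

open Summit.Ventures.FusionMHD.Bench.SolovevPCFIter.MercierEdge (eval_two_sub_sq eval_const_two sqrt_two_sub_pos uIcc01 continuousOn_invSqrt)

/-! ## §1 Constants and the g-free flux functions / averages of the edge surface -/

/-- `4αρ² = 102898253952/105397621975` (`|∇Ψ|² = 4αρ²·P/U` on the edge surface). [folklore] -/
def c4 : ℝ := (102898253952 / 105397621975 : ℝ)

/-- `αρ = 659604192/4215904879`. [folklore] -/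
def ar : ℝ := (659604192 / 4215904879 : ℝ)

/-- `K₄ = ∫₀^π U^{-3/2} dt` — the Qedge file's `edgeI`. [folklore] -/
def K4 : ℝ := edgeI

/-- `V″/V′` at the edge (`′ = d/dΨ`): `−K₂/(4αρK₁)`. [cite: Jardin2010, §5.3 eq. (5.29)] -/
def Vratio : ℝ := -K2 / (4 * ar * K1)

/-- `Φ″/(g·V′)` at the edge: `−3K₃/(8π·αρ·K₁)` (`Φ′ = g∮dl/(R|∇Ψ|)` [Jardin (5.31)], `Φ″` by differentiating under the integral).
[cite: Jardin2010, §5.3 eq. (5.31)] -/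
def phihat : ℝ := -(3 * K3) / (8 * π * ar * K1)

/-- `⟨1/R²⟩ = K₄/K₁`. [cite: Jardin2010, §5.3 eq. (5.30)] -/
def A4 : ℝ := K4 / K1
/-- `⟨R²⟩ = K₅/K₁`. [cite: Jardin2010, §5.3 eq. (5.30)] -/
def A5 : ℝ := K5 / K1
/-- `⟨1/|∇Ψ|²⟩ = K₆/(4αρ²K₁)`. [cite: Jardin2010, §5.3 eq. (5.30)] -/
def A6 : ℝ := K6 / (c4 * K1)
/-- `⟨1/(R²|∇Ψ|²)⟩ = K₇/(4αρ²K₁)`. [cite: Jardin2010, §5.3 eq. (5.30)] -/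
def A7 : ℝ := K7 / (c4 * K1)
/-- `⟨R²/|∇Ψ|²⟩ = K₈/(4αρ²K₁)`. [cite: Jardin2010, §5.3 eq. (5.30)] -/
def A8 : ℝ := K8 / (c4 * K1)

/-- `⟨B²/|∇Ψ|²⟩(g) = g²⟨1/(R²|∇Ψ|²)⟩ + ⟨1/R²⟩` (`B² = (g² + |∇Ψ|²)/R²`). [cite: Jardin2010, §8.5 eq. (8.134)] -/
def B2G (g : ℝ) : ℝ := g ^ 2 * A7 + A4

/-! ## §2 The two g-dependent averages as honest integrals -/

/-- Integrand of `KY(g) = K₁·⟨1/B²⟩(g)`: `Σ_σ 2·U_σ√U_σ/((g²U_σ + 4αρ²P_σ)·√(2−w²))` (`1/B² = R²U/(g²U + 4αρ²P)`). [folklore] -/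
def yfun (g w : ℝ) : ℝ :=
  (Uplus w * Real.sqrt (Uplus w) / (g ^ 2 * Uplus w + c4 * Pplus w) * (Real.sqrt (2 - w ^ 2))⁻¹ +
    Uminus w * Real.sqrt (Uminus w) / (g ^ 2 * Uminus w + c4 * Pminus w) * (Real.sqrt (2 - w ^ 2))⁻¹) * 2

/-- `KY(g) = ∫₀¹ yfun g`. [folklore] -/
def KY (g : ℝ) : ℝ := ∫ w in (0 : ℝ)..1, yfun g w

/-- `⟨1/B²⟩(g) = KY(g)/K₁`. [cite: Jardin2010, §8.5 eq. (8.134)] -/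
def Yavg (g : ℝ) : ℝ := KY g / K1

/-- Integrand of `KX(g) = K₁·g²⟨1/(B²|∇Ψ|²)⟩(g)`: `Σ_σ 2·g²U_σ²√U_σ/((g²U_σ + 4αρ²P_σ)·(4αρ²P_σ)·√(2−w²))`. [folklore] -/
def xfun (g w : ℝ) : ℝ :=
  (g ^ 2 * (Uplus w ^ 2 * Real.sqrt (Uplus w)) / ((g ^ 2 * Uplus w + c4 * Pplus w) * (c4 * Pplus w)) *
      (Real.sqrt (2 - w ^ 2))⁻¹ +
    g ^ 2 * (Uminus w ^ 2 * Real.sqrt (Uminus w)) / ((g ^ 2 * Uminus w + c4 * Pminus w) * (c4 * Pminus w)) *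
      (Real.sqrt (2 - w ^ 2))⁻¹) * 2

/-- `KX(g) = ∫₀¹ xfun g`. [folklore] -/
def KX (g : ℝ) : ℝ := ∫ w in (0 : ℝ)..1, xfun g w

/-- `g²⟨1/(B²|∇Ψ|²)⟩(g) = KX(g)/K₁`. [cite: Jardin2010, §8.5 eq. (8.134)] -/
def Xavg (g : ℝ) : ℝ := KX g / K1

/-! (Statements below spell the instance's objects with their namespace qualifier `SolovevPCFNstx.` /
`MercierEdge.` so that they are textually distinct from the ITER-like twin's.) -/

/-! ## §4 Elementary analysis on `[0,1]`: positivity, continuity, the two uniform bounds -/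

/-- `U₊ > 0` on `[0,1]` (`U₊(w) = u₀ + ρ(1 − w²) ≥ u₀`). [folklore] -/
theorem Uplus_pos {w : ℝ} (hw : w ∈ Icc (0 : ℝ) 1) : 0 < SolovevPCFNstx.Uplus w := by
  unfold Uplus; obtain ⟨h0, h1⟩ := hw; push_cast; nlinarith

/-- `U₋ > 0` everywhere (`U₋(w) = (1−ε)² + ρw²`). [folklore] -/
theorem Uminus_pos (w : ℝ) : 0 < SolovevPCFNstx.Uminus w := by
  unfold Uminus; push_cast; positivity

/-- `P₊ > 0` on `[0,1]`: `P = α(2sU + ρ(1−s²))² + 4|d₃|U²(1−s²)` with `1 − s² = w²(2 − w²) ≥ 0`; at `w = 0` the square is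
`(2U)² > 0`, for `w > 0` the second term is positive. [folklore] -/
theorem Pplus_pos {w : ℝ} (hw : w ∈ Icc (0 : ℝ) 1) : 0 < MercierEdge.Pplus w := by
  have hU := Uplus_pos hw
  obtain ⟨h0, h1⟩ := hw
  rw [Pplus_eq]
  have hs : 1 - splus w ^ 2 = w ^ 2 * (2 - w ^ 2) := by unfold splus; ring
  rw [hs]
  rcases eq_or_lt_of_le h0 with h | h
  · subst h
    have : splus 0 = 1 := by unfold splus; norm_num
    rw [this]; norm_num
    positivity
  · have h2 : 0 < w ^ 2 * (2 - w ^ 2) := by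
      have : 0 < 2 - w ^ 2 := by nlinarith
      positivity
    have h3 : 0 < (833319279 / 8431809758 : ℝ) * Uplus w ^ 2 * (w ^ 2 * (2 - w ^ 2)) := by positivity
    have h4 : 0 ≤ (422823200 / 4215904879 : ℝ) * (2 * splus w * Uplus w + (39 / 25 : ℝ) * (w ^ 2 * (2 - w ^ 2))) ^ 2 := by positivity
    linarith

/-- `P₋ > 0` on `[0,1]` (same argument). [folklore] -/
theorem Pminus_pos {w : ℝ} (hw : w ∈ Icc (0 : ℝ) 1) : 0 < MercierEdge.Pminus w := by
  have hU := Uminus_pos w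
  obtain ⟨h0, h1⟩ := hw
  rw [Pminus_eq]
  have hs : 1 - sminus w ^ 2 = w ^ 2 * (2 - w ^ 2) := by unfold sminus; ring
  rw [hs]
  rcases eq_or_lt_of_le h0 with h | h
  · subst h
    have : sminus 0 = -1 := by unfold sminus; norm_num
    rw [this]; norm_num
    positivity
  · have h2 : 0 < w ^ 2 * (2 - w ^ 2) := by
      have : 0 < 2 - w ^ 2 := by nlinarith
      positivity
    have h3 : 0 < (833319279 / 8431809758 : ℝ) * Uminus w ^ 2 * (w ^ 2 * (2 - w ^ 2)) := by positivity
    have h4 : 0 ≤ (422823200 / 4215904879 : ℝ) * (2 * sminus w * Uminus w + (39 / 25 : ℝ) * (w ^ 2 * (2 - w ^ 2))) ^ 2 := by positivity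
    linarith

/-- `c4 > 0`. [folklore] -/
theorem c4_pos : 0 < c4 := by unfold c4; norm_num

/-- Continuity of `U₊`. [folklore] -/
theorem continuous_Uplus : Continuous SolovevPCFNstx.Uplus := by unfold Uplus; fun_prop
/-- Continuity of `U₋`. [folklore] -/
theorem continuous_Uminus : Continuous SolovevPCFNstx.Uminus := by unfold Uminus; fun_prop
/-- Continuity of `P₊`. [folklore] -/
theorem continuous_Pplus : Continuous MercierEdge.Pplus := by unfold Pplus; fun_prop
/-- Continuity of `P₋`. [folklore] -/
theorem continuous_Pminus : Continuous MercierEdge.Pminus := by unfold Pminus; fun_prop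

/-- `yfun g` is continuous on `[0,1]` for `g ≠ 0`. [folklore] -/
theorem continuousOn_yfun {g : ℝ} (hg : g ≠ 0) : ContinuousOn (yfun g) (Icc 0 1) := by
  have hd1 : ∀ w ∈ Icc (0:ℝ) 1, g ^ 2 * Uplus w + c4 * Pplus w ≠ 0 := fun w hw => by
    have := Uplus_pos hw; have := Pplus_pos hw; have := c4_pos; positivity
  have hd2 : ∀ w ∈ Icc (0:ℝ) 1, g ^ 2 * Uminus w + c4 * Pminus w ≠ 0 := fun w hw => by
    have := Uminus_pos w; have := Pminus_pos hw; have := c4_pos; positivity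
  unfold yfun
  apply ContinuousOn.mul _ continuousOn_const
  apply ContinuousOn.add
  · apply ContinuousOn.mul _ continuousOn_invSqrt
    apply ContinuousOn.div _ _ hd1
    · exact (continuous_Uplus.mul (Real.continuous_sqrt.comp continuous_Uplus)).continuousOn
    · exact ((continuous_const.mul continuous_Uplus).add (continuous_const.mul continuous_Pplus)).continuousOn
  · apply ContinuousOn.mul _ continuousOn_invSqrt
    apply ContinuousOn.div _ _ hd2
    · exact (continuous_Uminus.mul (Real.continuous_sqrt.comp continuous_Uminus)).continuousOn
    · exact ((continuous_const.mul continuous_Uminus).add (continuous_const.mul continuous_Pminus)).continuousOn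

/-- `xfun g` is continuous on `[0,1]`. [folklore] -/
theorem continuousOn_xfun (g : ℝ) : ContinuousOn (xfun g) (Icc 0 1) := by
  have hd1 : ∀ w ∈ Icc (0:ℝ) 1, (g ^ 2 * Uplus w + c4 * Pplus w) * (c4 * Pplus w) ≠ 0 := fun w hw => by
    have := Uplus_pos hw; have := Pplus_pos hw; have := c4_pos; positivity
  have hd2 : ∀ w ∈ Icc (0:ℝ) 1, (g ^ 2 * Uminus w + c4 * Pminus w) * (c4 * Pminus w) ≠ 0 := fun w hw => by
    have := Uminus_pos w; have := Pminus_pos hw; have := c4_pos; positivity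
  unfold xfun
  apply ContinuousOn.mul _ continuousOn_const
  apply ContinuousOn.add
  · apply ContinuousOn.mul _ continuousOn_invSqrt
    apply ContinuousOn.div _ _ hd1
    · exact (continuous_const.mul ((continuous_Uplus.pow 2).mul (Real.continuous_sqrt.comp continuous_Uplus))).continuousOn
    · exact (((continuous_const.mul continuous_Uplus).add (continuous_const.mul continuous_Pplus)).mul
        (continuous_const.mul continuous_Pplus)).continuousOn
  · apply ContinuousOn.mul _ continuousOn_invSqrt
    apply ContinuousOn.div _ _ hd2
    · exact (continuous_const.mul ((continuous_Uminus.pow 2).mul (Real.continuous_sqrt.comp continuous_Uminus))).continuousOn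
    · exact (((continuous_const.mul continuous_Uminus).add (continuous_const.mul continuous_Pminus)).mul
        (continuous_const.mul continuous_Pminus)).continuousOn

/-- The `K₅` integrand in closed form is continuous on `[0,1]`. [folklore] -/
theorem continuousOn_k5 : ContinuousOn (fun w => MercierEdge.K5e.toFun w * Poly.eval [2] w) (Icc 0 1) := by
  have e : (fun w => K5e.toFun w * Poly.eval [2] w) = fun w =>
      (Real.sqrt (Uplus w) * (Real.sqrt (2 - w ^ 2))⁻¹ + Real.sqrt (Uminus w) * (Real.sqrt (2 - w ^ 2))⁻¹) * 2 := by
    funext w; rw [toFun_K5e, eval_const_two]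
  rw [e]
  apply ContinuousOn.mul _ continuousOn_const
  apply ContinuousOn.add
  · exact (Real.continuous_sqrt.comp continuous_Uplus).continuousOn.mul continuousOn_invSqrt
  · exact (Real.continuous_sqrt.comp continuous_Uminus).continuousOn.mul continuousOn_invSqrt

/-- The `K₈` integrand in closed form is continuous on `[0,1]` (`P_σ > 0` there). [folklore] -/
theorem continuousOn_k8 : ContinuousOn (fun w => MercierEdge.K8e.toFun w * Poly.eval [2] w) (Icc 0 1) := by
  have e : (fun w => K8e.toFun w * Poly.eval [2] w) = fun w =>
      (Uplus w * Real.sqrt (Uplus w) * (Pplus w)⁻¹ * (Real.sqrt (2 - w ^ 2))⁻¹ +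
        Uminus w * Real.sqrt (Uminus w) * (Pminus w)⁻¹ * (Real.sqrt (2 - w ^ 2))⁻¹) * 2 := by
    funext w; rw [toFun_K8e, eval_const_two]
  rw [e]
  apply ContinuousOn.mul _ continuousOn_const
  apply ContinuousOn.add
  · apply ContinuousOn.mul _ continuousOn_invSqrt
    apply ContinuousOn.mul
    · exact (continuous_Uplus.mul (Real.continuous_sqrt.comp continuous_Uplus)).continuousOn
    · exact continuous_Pplus.continuousOn.inv₀ (fun w hw => (Pplus_pos hw).ne')
  · apply ContinuousOn.mul _ continuousOn_invSqrt
    apply ContinuousOn.mul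
    · exact (continuous_Uminus.mul (Real.continuous_sqrt.comp continuous_Uminus)).continuousOn
    · exact continuous_Pminus.continuousOn.inv₀ (fun w hw => (Pminus_pos hw).ne')

/-- Pointwise: `0 ≤ yfun g w ≤ (K₅-integrand)(w)/g²` on `[0,1]` (`4αρ²P ≥ 0` dropped from the denominator). [folklore] -/
theorem yfun_le {g : ℝ} (hg : g ≠ 0) {w : ℝ} (hw : w ∈ Icc (0 : ℝ) 1) :
    0 ≤ yfun g w ∧ yfun g w ≤ K5e.toFun w * Poly.eval [2] w / g ^ 2 := by
  have hU1 := Uplus_pos hw; have hU2 := Uminus_pos w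
  have hP1 := Pplus_pos hw; have hP2 := Pminus_pos hw; have hc := c4_pos
  have hS := sqrt_two_sub_pos hw
  have hg2 : 0 < g ^ 2 := by positivity
  rw [toFun_K5e, eval_const_two]
  unfold yfun
  constructor
  · positivity
  · have b1 : Uplus w * Real.sqrt (Uplus w) / (g ^ 2 * Uplus w + c4 * Pplus w) ≤ Real.sqrt (Uplus w) / g ^ 2 := by
      rw [div_le_div_iff₀ (by positivity) hg2]
      have : 0 ≤ Real.sqrt (Uplus w) := Real.sqrt_nonneg _
      nlinarith [mul_nonneg this (mul_nonneg hc.le hP1.le)]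
    have b2 : Uminus w * Real.sqrt (Uminus w) / (g ^ 2 * Uminus w + c4 * Pminus w) ≤ Real.sqrt (Uminus w) / g ^ 2 := by
      rw [div_le_div_iff₀ (by positivity) hg2]
      have : 0 ≤ Real.sqrt (Uminus w) := Real.sqrt_nonneg _
      nlinarith [mul_nonneg this (mul_nonneg hc.le hP2.le)]
    have hR : 0 ≤ (Real.sqrt (2 - w ^ 2))⁻¹ := inv_nonneg.mpr hS.le
    have e : (Real.sqrt (Uplus w) * (Real.sqrt (2 - w ^ 2))⁻¹ + Real.sqrt (Uminus w) * (Real.sqrt (2 - w ^ 2))⁻¹) * 2 / g ^ 2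
        = (Real.sqrt (Uplus w) / g ^ 2 * (Real.sqrt (2 - w ^ 2))⁻¹ + Real.sqrt (Uminus w) / g ^ 2 * (Real.sqrt (2 - w ^ 2))⁻¹) * 2 := by
      field_simp
    rw [e]
    gcongr

/-- Pointwise: `0 ≤ xfun g w ≤ (K₈-integrand)(w)/(4αρ²)` on `[0,1]` (`g²U/(g²U + 4αρ²P) ≤ 1`). [folklore] -/
theorem xfun_le (g : ℝ) {w : ℝ} (hw : w ∈ Icc (0 : ℝ) 1) :
    0 ≤ xfun g w ∧ xfun g w ≤ K8e.toFun w * Poly.eval [2] w / c4 := by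
  have hU1 := Uplus_pos hw; have hU2 := Uminus_pos w
  have hP1 := Pplus_pos hw; have hP2 := Pminus_pos hw; have hc := c4_pos
  have hS := sqrt_two_sub_pos hw
  rw [toFun_K8e, eval_const_two]
  unfold xfun
  constructor
  · positivity
  · have b1 : g ^ 2 * (Uplus w ^ 2 * Real.sqrt (Uplus w)) / ((g ^ 2 * Uplus w + c4 * Pplus w) * (c4 * Pplus w))
        ≤ Uplus w * Real.sqrt (Uplus w) * (Pplus w)⁻¹ / c4 := by
      rw [show Uplus w * Real.sqrt (Uplus w) * (Pplus w)⁻¹ / c4 = Uplus w * Real.sqrt (Uplus w) / (c4 * Pplus w) by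
        field_simp]
      rw [div_le_div_iff₀ (by positivity) (by positivity)]
      have : 0 ≤ Real.sqrt (Uplus w) := Real.sqrt_nonneg _
      nlinarith [mul_nonneg (mul_nonneg this hU1.le) (mul_nonneg (mul_nonneg hc.le hP1.le) (mul_nonneg hc.le hP1.le))]
    have b2 : g ^ 2 * (Uminus w ^ 2 * Real.sqrt (Uminus w)) / ((g ^ 2 * Uminus w + c4 * Pminus w) * (c4 * Pminus w))
        ≤ Uminus w * Real.sqrt (Uminus w) * (Pminus w)⁻¹ / c4 := by
      rw [show Uminus w * Real.sqrt (Uminus w) * (Pminus w)⁻¹ / c4 = Uminus w * Real.sqrt (Uminus w) / (c4 * Pminus w) by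
        field_simp]
      rw [div_le_div_iff₀ (by positivity) (by positivity)]
      have : 0 ≤ Real.sqrt (Uminus w) := Real.sqrt_nonneg _
      nlinarith [mul_nonneg (mul_nonneg this hU2.le) (mul_nonneg (mul_nonneg hc.le hP2.le) (mul_nonneg hc.le hP2.le))]
    have hR : 0 ≤ (Real.sqrt (2 - w ^ 2))⁻¹ := inv_nonneg.mpr hS.le
    have e : (Uplus w * Real.sqrt (Uplus w) * (Pplus w)⁻¹ * (Real.sqrt (2 - w ^ 2))⁻¹ +
          Uminus w * Real.sqrt (Uminus w) * (Pminus w)⁻¹ * (Real.sqrt (2 - w ^ 2))⁻¹) * 2 / c4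
        = (Uplus w * Real.sqrt (Uplus w) * (Pplus w)⁻¹ / c4 * (Real.sqrt (2 - w ^ 2))⁻¹ +
          Uminus w * Real.sqrt (Uminus w) * (Pminus w)⁻¹ / c4 * (Real.sqrt (2 - w ^ 2))⁻¹) * 2 := by
      field_simp
    rw [e]
    gcongr

/-- **`0 ≤ KY(g) ≤ K₅/g²`**, i.e. `0 ≤ ⟨1/B²⟩ ≤ ⟨R²⟩/g²`. [folklore] -/
theorem KY_bounds {g : ℝ} (hg : g ≠ 0) : 0 ≤ KY g ∧ KY g ≤ K5 / g ^ 2 := by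
  constructor
  · exact intervalIntegral.integral_nonneg zero_le_one (fun w hw => (yfun_le hg hw).1)
  · unfold KY K5
    rw [← intervalIntegral.integral_div]
    apply intervalIntegral.integral_mono_on zero_le_one
    · exact (continuousOn_yfun hg).intervalIntegrable_of_Icc zero_le_one
    · exact (continuousOn_k5.div_const _).intervalIntegrable_of_Icc zero_le_one
    · intro w hw; exact (yfun_le hg hw).2

/-- **`0 ≤ KX(g) ≤ K₈/(4αρ²)`**, i.e. `0 ≤ g²⟨1/(B²|∇Ψ|²)⟩ ≤ ⟨R²/|∇Ψ|²⟩`. [folklore] -/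
theorem KX_bounds (g : ℝ) : 0 ≤ KX g ∧ KX g ≤ K8 / c4 := by
  constructor
  · exact intervalIntegral.integral_nonneg zero_le_one (fun w hw => (xfun_le g hw).1)
  · unfold KX K8
    rw [← intervalIntegral.integral_div]
    apply intervalIntegral.integral_mono_on zero_le_one
    · exact (continuousOn_xfun g).intervalIntegrable_of_Icc zero_le_one
    · exact (continuousOn_k8.div_const _).intervalIntegrable_of_Icc zero_le_one
    · intro w hw; exact (xfun_le g hw).2

end Summit.Ventures.FusionMHD.Bench.SolovevPCFNstx.MercierEdge

end
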